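import Mathlib
import HarnessLib
import HarnessLib.Audit
import Summits.HodgeConjecture.Statement
import Literature.AlgebraicGeometry.Motives.AbelianVariety
import HarnessLib.Audit.Status.Attr

/-!
Route: TropicalCuspLift

CLOSED (retired) 2026-08-16T07:07:53Z by planner-rchoice-HodgeConjecture-TropicalCuspLi-b645a78f-0 — reason: refuted-in-substance (route-choice): engine DepthOneLogLift = stmt-HodgeConjecture-2620 (informal crux, no decl, so no kernel ¬D can land) refuted on paper by three concurring crux-attack passes (K-balance/Kunneth obstruction; KBalance.lean — note: route-choice 2026-08-16 (planner rchoice-b645a78f): RETIRE. The route's engine stmt-HodgeConjecture-2620 DepthOneLogLift is refuted-substantive (3 concurring crux-attack passes gen-0/2/3; evidence CruxAttack_2620_DepthOneLogLift.md, CruxAttack_2620_g2.md, KBalance.lean rc0, CruxAttack_2620_g3.md); t. The file is kept as the record of this route; refuted decls are indexed as negative knowledge (`ledger negatives`).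

Route TropicalCuspLift — realises idea card tropical-cusp-log-semiregular-lift (and the grafts of
the retired boundary-anchor-log-semiregular). It suffices to show X = WEIL CLASSES ARE ALGEBRAIC IN
EVERY DIMENSION: for every complex abelian variety A of dimension 2n (n >= 2) carrying an
endomorphism phi with phi^2 = -d (d >= 1, so Q(sqrt -d) acts), every rational (n,n)-class in E_+ +
E_- is algebraic, where E_eps (eps = +-1) is the set of classes c in H^(2n)(A(C);C) with (x +
y.phi)^* c = (x + eps.i.y.sqrt d)^(2n) c for all natural x, y — E_eps = Wedge^(2n) of the
eps-eigenspace of phi^* on H^1, so E_+ + E_- = W_K tensor C is the complexified plane of Weil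
classes (Geemen1994 sec.4, Deligne1982HodgeCycles) and the statement is non-vacuous exactly for (A,
phi) of Weil type (signature (n,n)). Known: n = 2 for all K and discriminants (Markman2025SecantWeil
+ arXiv:2509.23079; hence HC for abelian 4- and 5-folds), n = 3 with disc = -1 (arXiv:2502.03415);
open: n = 3 with disc <> -1 mod Nm(K*) and every n >= 4 (arXiv:2603.20268 sec.1).
THE LINE (cusp anchoring + log-semiregular lifting, organised as an induction up the 'Witt tower'):
the hermitian form of a Weil triple of level n+1 is isotropic (Meyer), so EVERY component of the
level-(n+1) Weil locus — the Hodge locus of the Weil plane, algebraic by CDK — has depth-1 cusps,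
where A^(2n+2) degenerates semistably with torus rank 2 onto a level-n Weil-type abelian variety
B^(2n) of discriminant -disc(A), and the limit of the Weil plane is (Weil plane of B) tensor (the
weight-2 line Wedge^2_K of the vanishing/toric part). Anchor there: take a SEMIREGULAR perfect
complex E_B on B whose Chern character is theta-ballast + a non-zero Weil class (level n,
inductively; base n = 2: Markman's secant sheaves), form the log object E_0 = E_B boxtimes (toric
boundary data) on the snc central fibre, show it is LOG-semiregular, lift it over the log germ of
the toroidal boundary by the log form of the Bloch/Buchweitz-Flenner/Pridham/Perry semiregularity
theorem (the obstruction is the Hodge obstruction, identically zero on the Weil locus), obtain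
semiregular objects with Weil-type Chern character on all nearby A^(2n+2), and spread to the whole
component (Perry Thm 1.1 / relative Chow + Baire + CDK). The card's original maximal-degeneration
version (deepest cusp, tropical Hodge conjecture for rational-parameter tropical Weil tori,
Zharkov's explicit w_1, w_2) is kept as the non-inductive variant for the hyperbolic components disc
= (-1)^n, where alone a totally toric cusp exists (Witt index n iff disc = (-1)^n mod norms, else
n-1).
Lean X (elaborates: folder Sketch.lean rc 0 with `import
Literature.AlgebraicGeometry.Motives.AbelianVariety`; no `open` needed; constants checked with lean
search: Literature.AlgebraicGeometry.Motives.AbelianVariety (.dim, .X, Hom = group-scheme homs,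
AddCommGroup on A ⟶ A), Literature.AlgebraicGeometry.Motives.IsSmoothProjective,
Literature.AlgebraicGeometry.Motives.AlgPoints.mapContinuous,
Literature.AlgebraicTopology.SingularHomology.singularCohomology(.map),
Literature.AlgebraicGeometry.HodgeTheory.IsRationalClass / IsOfHodgeType / algebraicClasses,
CategoryTheory.CategoryStruct.comp/id):
∀ (n : ℕ), 2 ≤ n → ∀ (d : ℕ), 0 < d → ∀ (A : Literature.AlgebraicGeometry.Motives.AbelianVariety ℂ)
(φ : A ⟶ A), A.dim = 2 * n → Literature.AlgebraicGeometry.Motives.IsSmoothProjective (2 * n) A.X →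
CategoryTheory.CategoryStruct.comp φ φ = -(d • CategoryTheory.CategoryStruct.id A) → ∀ c :
Literature.AlgebraicTopology.SingularHomology.singularCohomology ℂ ℂ
(Literature.AlgebraicGeometry.Motives.ComplexPoints A.X) (2 * n),
Literature.AlgebraicGeometry.HodgeTheory.IsRationalClass c →
Literature.AlgebraicGeometry.HodgeTheory.IsOfHodgeType (2 * n) A.X (2 * n) n n c → (∃ c₁ c₂ :
Literature.AlgebraicTopology.SingularHomology.singularCohomology ℂ ℂ
(Literature.AlgebraicGeometry.Motives.ComplexPoints A.X) (2 * n), c = c₁ + c₂ ∧ (∀ x y : ℕ,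
Literature.AlgebraicTopology.SingularHomology.singularCohomology.map ℂ ℂ
(Literature.AlgebraicGeometry.Motives.AlgPoints.mapContinuous (L := ℂ) (x •
CategoryTheory.CategoryStruct.id A + y • φ).hom.hom.hom) (2 * n) c₁ = ((x : ℂ) + (y : ℂ) * Complex.I
* (Real.sqrt d : ℂ)) ^ (2 * n) • c₁) ∧ (∀ x y : ℕ,
Literature.AlgebraicTopology.SingularHomology.singularCohomology.map ℂ ℂ
(Literature.AlgebraicGeometry.Motives.AlgPoints.mapContinuous (L := ℂ) (x •
CategoryTheory.CategoryStruct.id A + y • φ).hom.hom.hom) (2 * n) c₂ = ((x : ℂ) - (y : ℂ) * Complex.I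
* (Real.sqrt d : ℂ)) ^ (2 * n) • c₂)) → c ∈
Literature.AlgebraicGeometry.HodgeTheory.algebraicClasses A.X n
Frames: item Assembly = X → HodgeConjecture is, honestly, the COMPLEMENT of the scope (the rest of
the Hodge conjecture; implied by HodgeConjecture itself; shared by every Weil-class route; not
claimed by this line). The mechanism's own glue is typed and provable now: EngineGlue =
WeilFourfoldsBase → WittTowerStep → X (Nat.le_induction), with WeilFourfoldsBase = X at n = 2
(Markman's theorem, support) and WittTowerStep = ∀ n >= 2, X(n) → X(n+1) (rank-2 crux, the home of
the cusp engine); WeilSixfolds = X at n = 3 is the rank-3 crux (first open level, shared target for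
direct attacks).

Rationale: WHY THIS LINE. Every algebraicity proof for Weil classes anchors at an INTERIOR special point and
propagates along the Weil locus by semiregularity (Schoen; Markman2025SecantWeil: secant sheaves on
X x X-hat + Buchweitz-Flenner; Perry arXiv:2604.00511 Thm 1.1 turns 'one semiregular perfect complex
at one point of a SMOOTH proper family, class Hodge along S => algebraic at every point' into a
clean theorem). The unused anchors are the CUSPS (card tropical-cusp-log-semiregular-lift):
Kontsevich/Zharkov arXiv:2002.02347 visit the maximal degeneration only to REFUTE ('converse may be
false'); there the variety is combinatorial and the remaining analysis is a LOG deformation problem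
whose obstruction is the Hodge obstruction, zero on the Weil locus. Planning turned up the
arithmetic that organises the cusps: the Weil hermitian form (signature (n,n) over K = Q(sqrt -d))
has Witt index n iff disc = (-1)^n mod Nm(K*) and n-1 otherwise (Meyer on the trace form + the
binary case) — totally toric cusps exist exactly on the components already settled (fourfolds disc
1: Schoen/van Geemen/Markman; sixfolds disc -1: Markman), while EVERY component has depth-1 cusps
whose abelian part is a Weil-type B of level n-1 and discriminant -disc. Hence the route's
organisation: climb the Witt tower by induction on n from Markman's fourfolds, lifting SEMIREGULAR
OBJECTS (not just classes) through depth-1 cusps; the tropical input shrinks to a real 2-torus, and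
the card's maximal-degeneration/tropical-HC attack survives as the variant for hyperbolic
components. Imported areas: log/tropical geometry (Mumford and Faltings-Chai degenerations
doi:10.1007/978-3-662-02632-8; Nishinou arXiv:2007.16148 = the dim-1 model: tropical curves in real
2-tori lift to Mumford degenerations of abelian surfaces iff a combinatorial condition holds),
derived deformation theory (Bloch1972Semiregularity, BuchweitzFlenner2003, Pridham arXiv:1208.3111,
Bandiera-Lepri-Manetti arXiv:2111.12985, Perry), hermitian forms over imaginary quadratic fields
(Landherr).
RANKED CRUXES (typed; the informal mechanism statements DepthOneLogLift, SemiregularInheritance,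
DeepCuspTropicalVariant are filed right after open and carry the definitions requested).
 rank 2 WittTowerStep: forall n >= 2, X(n) -> X(n+1). Home of the engine: depth-1 cusp anchor, log
object E_B boxtimes toric data, log-semiregularity, log Buchweitz-Flenner-Perry lift, spreading.
Honest gap recorded in SemiregularInheritance: the induction really transports 'semiregular
representative on an open subset of every component', which X(n) alone does not give.
 rank 3 WeilSixfolds: X(3). First open level (disc <> -1 for every K; arXiv:2603.20268: 'completely
open', CM points on McMullen's curve 'resist all known methods'); reachable from Markman's fourfolds
by ONE tower step, and the natural shared target of the direct attacks (cards
weil-discriminant-exposed-ray, volume-form-lagrangians-weil-classes,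
mirror-lagrangian-branes-for-weil-classes).
 support WeilFourfoldsBase: X(2) = Markman's theorem (all K, all disc), the induction base, typed so
that EngineGlue: WeilFourfoldsBase -> WittTowerStep -> X is an honest one-line induction (checked in
Sketch.lean). support BaireSpreading: the Mathlib skeleton of 'algebraic on a Euclidean-open subset
of an irreducible Hodge-locus component => everywhere' (proved in Sketch.lean; calibration).
Assembly: X -> HodgeConjecture (scope complement, see thesis).
KILL CRITERIA. (i) At a depth-1 cusp with NON-SPLIT extension data, the log-semiregularity map of
E_B boxtimes (toric data) fails to be injective for every semiregular E_B (a computation on P^1 x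
P^1-bundles over B; start with B = E x E, n = 1 -> fourfolds, where the answer is known) — kills
DepthOneLogLift and empties WittTowerStep of its mechanism. (ii) A component of some level-n Weil
locus on which NO class theta-polynomial + non-zero Weil part is the Chern character of a
semiregular perfect complex — kills SemiregularInheritance (complete intersections are excluded for
n >= 3 by h^1(N) > h^{n-1,n+1}-type counts, card semiregular-ci-at-product-anchors; secant sheaves
are the only known supply). (iii) Kontsevich's certificate: a rational-parameter tropical Weil
2n-torus (n >= 3, disc = (-1)^n) whose Weil classes are not tropical cycle classes kills
DeepCuspTropicalVariant and, by specialisation of cycles, the Hodge conjecture itself — run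
Zharkov's finite linear algebra at d = 1, n = 3 (kit). (iv) Any non-algebraic Weil class refutes X,
WeilSixfolds or WittTowerStep directly (Weil 1977's candidates).
NOT DECOMPOSED YET: the log semiregularity THEOREM as a separate item (it sits inside
DepthOneLogLift until a definer lands log-smooth families and the Buchweitz-Flenner map);
twisted/Brauer data in the lifted objects (Perry); level structure and the choice of toroidal fan;
the general engine beyond Weil classes (any Hodge class with a cusp-accessible Hodge-locus
component) and rigid classes (out of scope by design: cards bku-finite-tree-of-flavours,
qbar-anchors-kou-andre-motivated); HC for CM abelian varieties as a corollary of X (Andre 1992) is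
not filed.
NOVELTY (full text under Novelty): nearest prior = Kontsevich-Zharkov (refutation direction), Liu
arXiv:1702.00047 / Jell2022 Q.11.1 (the non-archimedean statement, no engine), Amini-Piquerez
arXiv:2012.13142 (tropical HC, triangulable case, tori excluded), Markman/Perry (semiregular lifting
from interior points, smooth families), Nishinou (curves). Delta: cusp anchors + LOG-semiregular
lifting of objects + spreading, organised by the Witt-index dictionary into an induction on n with
Markman's fourfolds as base. Card audited new-combination.
BARRIERS (full text under Barriers): Weil1977 exceptional classes = the target itself; Zucker/Voisin
Kaehler tori evaded by projectivity (degenerations, CDK, Chow); Atiyah-Hirzebruch/Kollar + Engel-de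
Gaay Fortman-Schreieder arXiv:2507.15704 => Q-coefficients built in; normal-function/Griffiths-group
barriers not met; CDK used positively; Andre motivated classes: proving side only.

Novelty: NOVELTY (searches run 2026-08-15 in this planning session, on top of the card's two novelty audits):
lit read of arXiv:2502.03415 pp.2-3 (Markman: Weil sixfolds disc -1 via Buchweitz-Flenner
semiregularity at X x X-hat; HC for abelian fourfolds), arXiv:2603.20268 pp.1-3 (2026 survey
sentence: 'for g = 3 ... outside [disc -1] the Hodge conjecture for Weil classes on sixfolds remains
completely open'; CM Weil points on McMullen's curve 'resist all known methods: CM isolation, absent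
secant geometry, uncontrolled discriminant'), arXiv:2507.15704 pp.1-4 (Engel-de Gaay
Fortman-Schreieder: multivariable Mumford degenerations + matroids => integral HC FALSE for curve
classes on very general ppav of dim >= 4; 'rational HC for abelian 4- and 5-folds recently proved by
Markman'), arXiv:2002.02347 (Zharkov, read in full: Kontsevich's tropical test, explicit tropical
Weil classes w_1, w_2, 'the converse implication though may be false'), arXiv:2012.13142 pp.1-4, 9
(Amini-Piquerez: tropical HC = ker N for rationally triangulable smooth projective tropical
varieties = canonical compactifications of polyhedral complexes in N_R, explicitly NOT tropical
abelian varieties), arXiv:2007.16148 pp.1-3 (Nishinou: realisation of tropical curves in real 2-tori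
by curves on Mumford degenerations of abelian surfaces via log smooth deformation theory; not every
tropical curve lifts), arXiv:2009.01651 pp.1-3 (Nishinou: semiregularity of maps, divisors, smooth
families), arXiv:2604.00511 pp.2-3 (Perry 202  [refs: 2502.03415, 2603.20268, 2507.15704, 2002.02347, 2012.13142, 2007.16148, 2009.01651, 2604.00511, 2111.12985, 1702.00047, 2509.23079]

Barriers (technique_class: log-semiregularity, cusp-degeneration, tropical): Literature.Barriers.HodgeConjecture.Weil1977_exceptionalHodgeClasses: APPLIES as the target, not as
an obstruction — the route's typed thesis WeilClassesAlgebraic is exactly the exceptional (Weil)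
classes; no cycle is written as a polynomial in divisor classes on A (only on the toric strata of
the degenerate fibre, where every class is), so the divisor-ring technique class is not used.
Literature.Barriers.HodgeConjecture.Mumford1968_simpleFourfold_exceptionalHodgeClasses: same; n = 2
is Markman's theorem and serves only as the consistency check of TropicalLimitCycles.
Literature.Barriers.HodgeConjecture.Zucker1977_kaehlerTorus_noAnalyticCycles and
Literature.Barriers.HodgeConjecture.Voisin2002_weilTorus_hodgeClassWithoutSubvarieties: EVADED by
projectivity entering three times — Mumford/Faltings-Chai degenerations and toroidal
compactifications exist for POLARISED families only, CDK algebraicity of the Weil locus needs an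
algebraic base, and BaireSpreading is instantiated with relative Chow schemes (proper); a
non-algebraic Weil torus has no cusp inside a polarised Hodge locus.
Literature.Barriers.HodgeConjecture.AtiyahHirzebruch1962_torsionClass_notAlgebraic and
Literature.Barriers.HodgeConjecture.Kollar1992_nonTorsionClass_notAlgebraic: CONSISTENT — all
representatives carry Q-coefficients (tropical cycles with rational weights, CI ballast subtracted
rationally); Engel-de Gaay Fortman-Schreieder arXiv:2507.15704 show the INTEGRAL version of
LogSemiregularRepresentative/Trop

Novelty grade: new-combination — ROUTE REVIEW (refuter rreview-f02808d9, gen 1, 2026-08-15; full text = TCL_RouteReview.md attached as evidence to stmt-2620). Grade concurs with the card's two audits: new-combination = semiregular lifting of OBJECTS (Bloch/BF/Markman/Perry, all from interior anchors, smooth families) × cusp anchors (refuter refuter-rreview-route-PneNP-OverlapGapAl-f02808d9-0, 2026-08-15T13:03:50Z; prior: arXiv:2502.03415 + arXiv:2509.23079 Markman (secant sheaves, Buchweitz-Flenner semiregular lifting from INTERIOR anchors; base X(2), X(3) disc -1); arXiv:2604.00511 Perry Thm 1.1 (smooth families only), arXiv:2002.02347 Zharkov/Kontsevich (maximal degeneration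 used to REFUTE; explicit tropical Weil classes); arXiv:2012.13142 Amini-Piquerez (tropical HC, triangulable case, tori excluded); arXiv:170)

History (route lifecycle, newest last):
- 2026-08-16T07:07:53Z · CLOSED retired — refuted-in-substance (route-choice): engine DepthOneLogLift = stmt-HodgeConjecture-2620 (informal crux, no decl, so no kernel ¬D can land) refuted on paper by three concurring crux-attack passes (K-ba (planner-rchoice-HodgeConjecture-TropicalCuspLi-b645a78f-0)

sub-problem: HodgeConjecture · status: closed(retired) · opened planner-plancard-HodgeConjecture-HodgeConject-375712dc-0 2026-08-15T11:05:11Z · rev 1 · ledger route-HodgeConjecture-TropicalCuspLift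
GENERATED by the gate from the ledger (D-0016/17). Provers cite these decls: `theorem foo : Summit.HodgeConjecture.HodgeConjecture.Theses.TropicalCuspLift.<Decl> := …` in Summits/HodgeConjecture/HodgeConjecture/Theorems/<Name>.lean.
-/

namespace Summit.HodgeConjecture.HodgeConjecture.Theses.TropicalCuspLift

open scoped BigOperators Topology Manifold Classical MeasureTheory ProbabilityTheory Matrix InnerProductSpace ComplexConjugate ContinuousMap
open Filter Set Function TopologicalSpace MeasureTheory

attribute [summit_statement] _root_.HodgeConjecture

/-- item stmt-HodgeConjecture-2522 · target · rank 0 · open · by planner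
why it might fail: It IS HC for Weil classes, known only for n=2 (all K, all disc: Markman2025SecantWeil, arXiv:2509.23079), n=3 disc -1 (arXiv:2502.03415), K=Q(√-3) disc 1 (Schoen): false iff one Weil class on a Weil-type A^{2n}, n≥3, is non-algebraic (Weil 1977's candidates; 'completely open', arXiv:2603.20268 p.3).
sources: arXiv:2603.20268, arXiv:2502.03415, Markman2025SecantWeil, arXiv:2509.23079, Geemen1994, Deligne1982HodgeCycles
[target] Thesis X: Weil classes are algebraic in every dimension 2n ≥ 4. Data: A abelian over ℂ of
dim 2n, φ : A ⟶ A with φ ≫ φ = -d (so K = ℚ(√-d) ↪ End⁰A). E_ε (ε = ±1) := {c ∈ H^{2n}(A(ℂ);ℂ) | ∀ x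
y : ℕ, (x + yφ)^* c = (x + ε·i·y·√d)^{2n} c}; since (ψ₁+ψ₂)^* is additive on H¹ of an abelian
variety and H^{2n} = ⋀^{2n}H¹ as a φ^*-representation, E_ε = ⋀^{2n}(ε i√d-eigenspace of φ^* on H¹)
is a line (the characters (x+iy√d)^a (x−iy√d)^b, a+b = 2n, are pairwise distinct polynomials in x,y)
and E_+ ⊕ E_- = W_K ⊗ ℂ is the complexified 2-plane of Weil classes (Geemen1994 §4,
Deligne1982HodgeCycles §4). Statement: every c rational and of Hodge type (n,n) with c = c₁ + c₂, c₁
∈ E_+, c₂ ∈ E_-, lies in algebraicClasses A.X n. If (A,φ) is not of signature (n,n), E_± have Hodge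
types (a,b),(b,a) with a ≠ b and the only rational (n,n)-class in E_+ + E_- is 0 (vacuous there, as
it should be). Known cases: n = 2 all K and all discriminants (Markman2025SecantWeil,
arXiv:2509.23079; earlier Schoen, van Geemen, Koike, Markman's generalized Kummers), n = 3 with disc
≡ -1 (arXiv:2502.03415, all K), n = 3 K = ℚ(√-3) trivial disc (Schoen); everything else open.
Consequences: HC for CM abelian varietie -/
@[route_item "route-HodgeConjecture-TropicalCuspLift", crux]
def WeilClassesAlgebraic : Prop :=
  ∀ (n : ℕ), 2 ≤ n → ∀ (d : ℕ), 0 < d → ∀ (A : Literature.AlgebraicGeometry.Motives.AbelianVariety ℂ) (φ : A ⟶ A), A.dim = 2 * n → Literature.AlgebraicGeometry.Motives.IsSmoothProjective (2 * n) A.X → CategoryTheory.CategoryStruct.comp φ φ = -(d • CategoryTheory.CategoryStruct.id A) → ∀ c : Literature.AlgebraicTopology.SingularHomology.singularCohomology ℂ ℂ (Literature.AlgebraicGeometry.Motives.ComplexPoints A.X) (2 * n), Literature.AlgebraicGeometry.HodgeTheory.IsRationalClass c → Literature.AlgebraicGeometry.HodgeTheory.IsOfHodgeType (2 * n) A.X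 (2 * n) n n c → (∃ c₁ c₂ : Literature.AlgebraicTopology.SingularHomology.singularCohomology ℂ ℂ (Literature.AlgebraicGeometry.Motives.ComplexPoints A.X) (2 * n), c = c₁ + c₂ ∧ (∀ x y : ℕ, Literature.AlgebraicTopology.SingularHomology.singularCohomology.map ℂ ℂ (Literature.AlgebraicGeometry.Motives.AlgPoints.mapContinuous (L := ℂ) (x • CategoryTheory.CategoryStruct.id A + y • φ).hom.hom.hom) (2 * n) c₁ = ((x : ℂ) + (y : ℂ) * Complex.I * (Real.sqrt d : ℂ)) ^ (2 * n) • c₁) ∧ (∀ x y : ℕ, Literature.AlgebraicTopology.SingularHomology.singularCohomology.map ℂ ℂ (Literature.AlgebraicGeometry.Motives.AlgPoints.mapContinuous (L := ℂ) (x • CategoryTheory.CategoryStruct.id A + y • φ).hom.hom.hom) (2 * n) c₂ = ((x : ℂ) - (y : ℂ) * Complex.I * (Real.sqrt d : ℂ)) ^ (2 * n) • c₂)) → c ∈ Literature.AlgebraicGeometry.HodgeTheory.algebraicClasses A.X n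

/-- item stmt-HodgeConjecture-2523 · crux · rank 2 · closed · moot by None · by planner
why it might fail: False iff Weil-class HC first fails at a level n+1≥3 (Weil 1977 candidates; sixfolds disc≠-1 'completely open', arXiv:2603.20268 p.3). The engine can fail: it needs a SEMIREGULAR object on B (X(n) gives classes only) and a log Buchweitz–Flenner theorem at an snc fibre, unwritten (Perry 1.1: smooth).
sources: arXiv:2603.20268, arXiv:2604.00511, BuchweitzFlenner2003, Bloch1972Semiregularity, arXiv:1208.3111, arXiv:2502.03415
[crux, rank 2 — home of the cusp engine] ∀ n ≥ 2, X(n) → X(n+1), X(m) = the thesis at half-dimension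
m (inlined). The intended proof is the DEPTH-1 CUSP LIFT: (1) anchors — the hermitian form H of a
level-(n+1) Weil triple (A^{2n+2}, K, h) has signature (n+1,n+1) ≥ (2,2), so its trace form is an
indefinite rational quadratic form of dimension 4n+4 ≥ 12 and H is isotropic (Meyer); an isotropic
K-line I ⊂ H₁(A,ℚ) is a rational boundary component of the Weil-type Shimura variety W(n+1,K,δ):
every irreducible component of the (level-m) Weil locus — which IS the Hodge locus of the Weil
plane, algebraic by CDK — has depth-1 cusps, and the boundary stratum is fibred over the FULL
level-n Weil locus of the K-hermitian space I^⊥/I (signature (n,n), discriminant -δ); over a small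
disc (or the log germ of the toroidal compactification, Faltings–Chai doi:10.1007/978-3-662-02632-8
/ Lan) through a boundary point the universal family has a K-equivariant projective semistable model
of torus rank 2 whose snc central fibre X₀ is a union of toric-surface bundles over torsors of the
abelian part B^{2n} (Mumford's relatively complete models). (2) limit class — K acts on H¹_lim
preserving the monodromy -/
@[route_item "route-HodgeConjecture-TropicalCuspLift", crux]
def WittTowerStep : Prop :=
  ∀ (n : ℕ), 2 ≤ n → (∀ (d : ℕ), 0 < d → ∀ (A : Literature.AlgebraicGeometry.Motives.AbelianVariety ℂ) (φ : A ⟶ A), A.dim = 2 * n → Literature.AlgebraicGeometry.Motives.IsSmoothProjective (2 * n) A.X → CategoryTheory.CategoryStruct.comp φ φ = -(d • CategoryTheory.CategoryStruct.id A) → ∀ c : Literature.AlgebraicTopology.SingularHomology.singularCohomology ℂ ℂ (Literature.AlgebraicGeometry.Motives.ComplexPoints A.X) (2 * n), Literature.AlgebraicGeometry.HodgeTheory.IsRationalClass c → Literature.AlgebraicGeometry.HodgeTheory.IsOfHodgeType (2 * n) A.X (2 * n) n n c → (∃ c₁ c₂ : Literature.AlgebraicTopology.SingularHomology.singularCohomology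 ℂ ℂ (Literature.AlgebraicGeometry.Motives.ComplexPoints A.X) (2 * n), c = c₁ + c₂ ∧ (∀ x y : ℕ, Literature.AlgebraicTopology.SingularHomology.singularCohomology.map ℂ ℂ (Literature.AlgebraicGeometry.Motives.AlgPoints.mapContinuous (L := ℂ) (x • CategoryTheory.CategoryStruct.id A + y • φ).hom.hom.hom) (2 * n) c₁ = ((x : ℂ) + (y : ℂ) * Complex.I * (Real.sqrt d : ℂ)) ^ (2 * n) • c₁) ∧ (∀ x y : ℕ, Literature.AlgebraicTopology.SingularHomology.singularCohomology.map ℂ ℂ (Literature.AlgebraicGeometry.Motives.AlgPoints.mapContinuous (L := ℂ) (x • CategoryTheory.CategoryStruct.id A + y • φ).hom.hom.hom) (2 * n) c₂ = ((x : ℂ) - (y : ℂ) * Complex.I * (Real.sqrt d : ℂ)) ^ (2 * n) • c₂)) → c ∈ Literature.AlgebraicGeometry.HodgeTheory.algebraicClasses A.X n) → (∀ (d : ℕ), 0 < d → ∀ (A : Literature.AlgebraicGeometry.Motives.AbelianVariety ℂ) (φ : A ⟶ A), A.dim = 2 * (n + 1) → Literature.AlgebraicGeometry.Motives.IsSmoothProjective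 (2 * (n + 1)) A.X → CategoryTheory.CategoryStruct.comp φ φ = -(d • CategoryTheory.CategoryStruct.id A) → ∀ c : Literature.AlgebraicTopology.SingularHomology.singularCohomology ℂ ℂ (Literature.AlgebraicGeometry.Motives.ComplexPoints A.X) (2 * (n + 1)), Literature.AlgebraicGeometry.HodgeTheory.IsRationalClass c → Literature.AlgebraicGeometry.HodgeTheory.IsOfHodgeType (2 * (n + 1)) A.X (2 * (n + 1)) (n + 1) (n + 1) c → (∃ c₁ c₂ : Literature.AlgebraicTopology.SingularHomology.singularCohomology ℂ ℂ (Literature.AlgebraicGeometry.Motives.ComplexPoints A.X) (2 * (n + 1)), c = c₁ + c₂ ∧ (∀ x y : ℕ, Literature.AlgebraicTopology.SingularHomology.singularCohomology.map ℂ ℂ (Literature.AlgebraicGeometry.Motives.AlgPoints.mapContinuous (L := ℂ) (x • CategoryTheory.CategoryStruct.id A + y • φ).hom.hom.hom) (2 * (n + 1)) c₁ = ((x : ℂ) + (y : ℂ) * Complex.I * (Real.sqrt d : ℂ)) ^ (2 * (n + 1)) • c₁) ∧ (∀ x y : ℕ, Literature.AlgebraicTopology.SingularHomology.singularCohomology.map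 ℂ ℂ (Literature.AlgebraicGeometry.Motives.AlgPoints.mapContinuous (L := ℂ) (x • CategoryTheory.CategoryStruct.id A + y • φ).hom.hom.hom) (2 * (n + 1)) c₂ = ((x : ℂ) - (y : ℂ) * Complex.I * (Real.sqrt d : ℂ)) ^ (2 * (n + 1)) • c₂)) → c ∈ Literature.AlgebraicGeometry.HodgeTheory.algebraicClasses A.X (n + 1))

-- item stmt-HodgeConjecture-2587 · crux · rank 2 · closed · moot by None · by planner — informal only, no Lean statement yet:
--   [crux — informal until `buchweitzFlennerSemiregularityMap` / perfect-complex semiregularity lands in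
--   Literature; the HONEST inductive invariant behind WittTowerStep] S(n): on a non-empty Euclidean-open
--   subset of EVERY irreducible component of the level-n Weil locus (all K = ℚ(√-d), all discriminants,
--   n ≥ 2) there is a (possibly Brauer-twisted) perfect complex E on A with Ext^{<0}(E,E) = 0,
--   SEMIREGULAR (Buchweitz–Flenner map σ = ⊕σ_k : Ext²(E,E) → ⊕_k H^{k+2}(A, Ω^k) injective), and a
--   rational class β ∈ H²(A,ℚ(1)) such that exp(β)·ch(E) ∈ ℚ[θ] ⊕ W_K(A) has NON-ZERO Weil component.
--   Facts: S(n) a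

-- item stmt-HodgeConjecture-2620 · crux · rank 2 · closed · moot by None · by planner — informal only, no Lean statement yet:
--   [crux — informal until a log-smooth/semistable-family notion (`LogSmoothDegeneration`) and the
--   semiregularity map land; the ENGINE inside WittTowerStep] Let W be an irreducible component of the
--   level-(n+1) Weil locus (n ≥ 2, K = ℚ(√-d), discriminant δ, level-m structure), W̄ a toroidal
--   compactification, b ∈ W̄ a boundary point of DEPTH 1 (isotropic K-line I ⊂ H₁; exists on every
--   component since the trace form of the Weil hermitian form is an indefinite rational quadratic form
--   of dimension 4n+4 ≥ 12 — Meyer), 𝒳 → (W̄, ∂) the K-equivariant projective semistable model of torus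
--   rank 2 near b (Mumf

/-- item stmt-HodgeConjecture-2524 · crux · rank 3 · open · by planner
why it might fail: Open: at n=3 only disc -1 (all K, arXiv:2502.03415) and K=Q(√-3) disc 1 (Schoen) are known; 'outside this locus … sixfolds remains completely open' (arXiv:2603.20268 p.3); CM Weil points resist CM isolation, secant geometry, disc control. False iff a Weil class on an abelian sixfold is non-algebraic
sources: arXiv:2603.20268, arXiv:2502.03415, Geemen1994, MoonenZarhin1999, Deligne1982HodgeCycles, Weil1977HodgeRing
[crux, rank 3] X(3): Weil classes on abelian SIXFOLDS (A, φ² = -d) are algebraic — the thesis at n =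
3, inlined. Markman (arXiv:2502.03415) proves it on the components of discriminant -1 for every K =
ℚ(√-d) via a simple reflexive secant sheaf on X×X̂ (X an abelian threefold) deformed by
Buchweitz–Flenner semiregularity over the 9-dimensional Weil moduli; Schoen did K = ℚ(√-3), trivial
discriminant. By the Witt-index dictionary the disc ≡ -1 components are exactly the ones with a
totally toric (maximal unipotent) cusp; the open components (disc ≢ -1) have Witt index 2: their
deepest degeneration has torus rank 4 over a (1,1) K-abelian surface (E×E with K ⊂ M₂(ℚ)), and their
depth-1 cusps sit over level-2 Weil fourfolds of discriminant -disc, where Markman's theorem AND his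
semiregular secant sheaves are available — so X(3) is ONE application of the depth-1 lift
(WittTowerStep at n = 2) away from print, which is why it is ranked right after the step. It is also
the natural shared target of the direct attacks filed as other cards (weil-discriminant-exposed-ray:
exposed rays rational iff (-1)^n det H trivial; volume-form-lagrangians-weil-classes;
mirror-lagrangian-branes-for-weil-clas -/
@[route_item "route-HodgeConjecture-TropicalCuspLift"]
def WeilSixfolds : Prop :=
  ∀ (d : ℕ), 0 < d → ∀ (A : Literature.AlgebraicGeometry.Motives.AbelianVariety ℂ) (φ : A ⟶ A), A.dim = 2 * 3 → Literature.AlgebraicGeometry.Motives.IsSmoothProjective (2 * 3) A.X → CategoryTheory.CategoryStruct.comp φ φ = -(d • CategoryTheory.CategoryStruct.id A) → ∀ c : Literature.AlgebraicTopology.SingularHomology.singularCohomology ℂ ℂ (Literature.AlgebraicGeometry.Motives.ComplexPoints A.X) (2 * 3), Literature.AlgebraicGeometry.HodgeTheory.IsRationalClass c → Literature.AlgebraicGeometry.HodgeTheory.IsOfHodgeType (2 * 3) A.X (2 * 3) 3 3 c → (∃ c₁ c₂ : Literature.AlgebraicTopology.SingularHomology.singularCohomology ℂ ℂ (Literature.AlgebraicGeometry.Motives.ComplexPoints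 A.X) (2 * 3), c = c₁ + c₂ ∧ (∀ x y : ℕ, Literature.AlgebraicTopology.SingularHomology.singularCohomology.map ℂ ℂ (Literature.AlgebraicGeometry.Motives.AlgPoints.mapContinuous (L := ℂ) (x • CategoryTheory.CategoryStruct.id A + y • φ).hom.hom.hom) (2 * 3) c₁ = ((x : ℂ) + (y : ℂ) * Complex.I * (Real.sqrt d : ℂ)) ^ (2 * 3) • c₁) ∧ (∀ x y : ℕ, Literature.AlgebraicTopology.SingularHomology.singularCohomology.map ℂ ℂ (Literature.AlgebraicGeometry.Motives.AlgPoints.mapContinuous (L := ℂ) (x • CategoryTheory.CategoryStruct.id A + y • φ).hom.hom.hom) (2 * 3) c₂ = ((x : ℂ) - (y : ℂ) * Complex.I * (Real.sqrt d : ℂ)) ^ (2 * 3) • c₂)) → c ∈ Literature.AlgebraicGeometry.HodgeTheory.algebraicClasses A.X 3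

-- item stmt-HodgeConjecture-2636 · crux · rank 3 · closed · moot by None · by planner — informal only, no Lean statement yet:
--   [crux, rank 3 — informal until tropical cycles on tropical tori (`tropicalTorusCycle` / tropical
--   homology) exist in Literature; the card's ORIGINAL non-inductive line, kept for the hyperbolic
--   components] For a Weil-locus component with disc ≡ (-1)^n mod Nm(K*) (Witt index n: a totally toric
--   = maximal-unipotent cusp exists; e.g. Markman's sixfold components disc -1, the fourfold components
--   disc 1), degenerate along an algebraic curve to a 0-dimensional cusp: K-equivariant Mumford
--   degeneration with toric snc central fibre X₀ and dual complex the tropical abelian variety B =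
--   ℝ^{2n}/Γ₁ with RATION

/-- item stmt-HodgeConjecture-2525 · support · rank 5 · closed · moot by None · by planner
[support — KNOWN IN PRINT, base of the induction] X(2): Weil classes on abelian FOURFOLDS (A, φ² =
-d) are algebraic for every d and every discriminant: Markman2025SecantWeil (= arXiv:2502.03415, via
the sixfold disc -1 theorem and degeneration X×X̂ → fourfolds) with arXiv:2509.23079
(real-multiplication secant sheaves; all discriminants), streamlined by Perry arXiv:2604.00511
§(simplifying Markman); earlier cases Schoen 1988/1998 (ℚ(√-3) all disc; ℚ(i) disc -1), van Geemen
(theta functions, ℚ(i)), Koike, Markman JEMS 2023 (generalized Kummers, disc 1 all K). With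
Moonen–Zarhin this gives HC for all abelian fourfolds (and fivefolds). Formalising any of these
proofs is far beyond the tree (hyperkähler/derived categories of abelian varieties); the item is
typed so that EngineGlue is an honest induction and so that a Literature named fact
`Markman2025_weilClasses_fourfolds` (cite item to be filed by a librarian) can discharge it as a
hypothesis where routes want X conditionally. Not a crux: nobody should try to refute it; provers
idle on this route should work on BaireSpreading/EngineGlue or --supports lemmas for WittTowerStep
instead. -/
@[route_item "route-HodgeConjecture-TropicalCuspLift", crux]
def WeilFourfoldsBase : Prop :=
  ∀ (d : ℕ), 0 < d → ∀ (A : Literature.AlgebraicGeometry.Motives.AbelianVariety ℂ) (φ : A ⟶ A), A.dim = 2 * 2 → Literature.AlgebraicGeometry.Motives.IsSmoothProjective (2 * 2) A.X → CategoryTheory.CategoryStruct.comp φ φ = -(d • CategoryTheory.CategoryStruct.id A) → ∀ c : Literature.AlgebraicTopology.SingularHomology.singularCohomology ℂ ℂ (Literature.AlgebraicGeometry.Motives.ComplexPoints A.X) (2 * 2), Literature.AlgebraicGeometry.HodgeTheory.IsRationalClass c → Literature.AlgebraicGeometry.HodgeTheory.IsOfHodgeType (2 * 2) A.X (2 * 2)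 2 2 c → (∃ c₁ c₂ : Literature.AlgebraicTopology.SingularHomology.singularCohomology ℂ ℂ (Literature.AlgebraicGeometry.Motives.ComplexPoints A.X) (2 * 2), c = c₁ + c₂ ∧ (∀ x y : ℕ, Literature.AlgebraicTopology.SingularHomology.singularCohomology.map ℂ ℂ (Literature.AlgebraicGeometry.Motives.AlgPoints.mapContinuous (L := ℂ) (x • CategoryTheory.CategoryStruct.id A + y • φ).hom.hom.hom) (2 * 2) c₁ = ((x : ℂ) + (y : ℂ) * Complex.I * (Real.sqrt d : ℂ)) ^ (2 * 2) • c₁) ∧ (∀ x y : ℕ, Literature.AlgebraicTopology.SingularHomology.singularCohomology.map ℂ ℂ (Literature.AlgebraicGeometry.Motives.AlgPoints.mapContinuous (L := ℂ) (x • CategoryTheory.CategoryStruct.id A + y • φ).hom.hom.hom) (2 * 2) c₂ = ((x : ℂ) - (y : ℂ) * Complex.I * (Real.sqrt d : ℂ)) ^ (2 * 2) • c₂)) → c ∈ Literature.AlgebraicGeometry.HodgeTheory.algebraicClasses A.X 2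

/-- item stmt-HodgeConjecture-2526 · support · rank 8 · closed · proved by Summit.HodgeConjecture.HodgeConjecture.Theorems.tropicalCuspLift_baireSpreading_proof @ 152140741c1b (prover) · by planner
[support — calibration, Mathlib-provable (10 lines in Sketch.lean: isMeagre_iUnion +
dense_of_mem_residual)] The topological skeleton of the spreading step: in a Baire space, countably
many closed sets each of which is either everything or has empty interior cannot cover a non-empty
open set unless one of them is everything. Instantiation (informal, needs relative Chow schemes on
real carriers): S = an irreducible component of the Weil/Hodge locus with its analytic topology
(Baire; irreducible ⇒ a proper Zariski-closed subset has empty interior), Z_i = images in S of the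
countably many components of the relative Chow scheme of codimension-n cycles of bounded degree
whose class is the flat Weil class (closed by properness) — 'algebraic on a Euclidean-open U ⊆ S ⇒
algebraic on all of S'. Perry arXiv:2604.00511 Thm 1.1 (second bullet) packages the same conclusion
for semiregular objects on smooth families. -/
@[route_item "route-HodgeConjecture-TropicalCuspLift"]
def BaireSpreading : Prop :=
  ∀ {S : Type} [TopologicalSpace S] [BaireSpace S] (Z : ℕ → Set S), (∀ i, IsClosed (Z i)) → (∀ i, Z i = Set.univ ∨ interior (Z i) = ∅) → ∀ U : Set S, IsOpen U → U.Nonempty → U ⊆ ⋃ i, Z i → ∃ i, Z i = Set.univ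

/-- item stmt-HodgeConjecture-2527 · support · rank 9 · closed · proved by Summit.HodgeConjecture.HodgeConjecture.Theorems.tropicalCuspLift_engineGlue_proof @ 07e4e5ccc7e5 (prover) · by planner
[support — the route's internal assembly, provable now] Base (n = 2, Markman) + tower step ⇒ thesis
for all n ≥ 2, by Nat.le_induction (one line; checked in the planner's Sketch.lean: `fun h2 hstep n
hn => Nat.le_induction h2 (fun m hm ih => hstep m hm ih) n hn`). References the decls
WeilFourfoldsBase, WittTowerStep, WeilClassesAlgebraic rendered above it in this file. Closing it is
calibration; the content is in WittTowerStep. -/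
@[route_item "route-HodgeConjecture-TropicalCuspLift"]
def EngineGlue : Prop :=
  WeilFourfoldsBase → WittTowerStep → WeilClassesAlgebraic

/-- item stmt-HodgeConjecture-2528 · assembly · rank 1 · closed · moot by None · by planner
[assembly] X → HodgeConjecture with X = WeilClassesAlgebraic inlined. HONEST STATUS: this frame is
the COMPLEMENT of the route's scope — the Hodge conjecture for everything that is not a Weil class —
and is NOT claimed by this line; it is implied by HodgeConjecture itself (so irrefutable unless HC
fails) and is expected to close only through other routes; it is filed because D-0019 frames every
route as Crux → … → summit and so that every Weil-class route shares one explicit statement of what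
remains. Known partial glue in print (not filed): X ⇒ HC for all CM abelian varieties (André 1992,
'Une remarque à propos des cycles de Hodge de type CM'), X + Moonen–Zarhin ⇒ HC for simple abelian
varieties of the types where Weil classes are the only exceptional classes. Refuters: do not spend
time here; provers: nothing to do unless HC is otherwise settled. -/
@[route_item "route-HodgeConjecture-TropicalCuspLift"]
def Assembly : Prop :=
  (∀ (n : ℕ), 2 ≤ n → ∀ (d : ℕ), 0 < d → ∀ (A : Literature.AlgebraicGeometry.Motives.AbelianVariety ℂ) (φ : A ⟶ A), A.dim = 2 * n → Literature.AlgebraicGeometry.Motives.IsSmoothProjective (2 * n) A.X → CategoryTheory.CategoryStruct.comp φ φ = -(d • CategoryTheory.CategoryStruct.id A) → ∀ c : Literature.AlgebraicTopology.SingularHomology.singularCohomology ℂ ℂ (Literature.AlgebraicGeometry.Motives.ComplexPoints A.X) (2 * n), Literature.AlgebraicGeometry.HodgeTheory.IsRationalClass c → Literature.AlgebraicGeometry.HodgeTheory.IsOfHodgeType (2 * n) A.X (2 * n) n n c → (∃ c₁ c₂ : Literature.AlgebraicTopology.SingularHomology.singularCohomology ℂ ℂ (Literature.AlgebraicGeometry.Motives.ComplexPoints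 A.X) (2 * n), c = c₁ + c₂ ∧ (∀ x y : ℕ, Literature.AlgebraicTopology.SingularHomology.singularCohomology.map ℂ ℂ (Literature.AlgebraicGeometry.Motives.AlgPoints.mapContinuous (L := ℂ) (x • CategoryTheory.CategoryStruct.id A + y • φ).hom.hom.hom) (2 * n) c₁ = ((x : ℂ) + (y : ℂ) * Complex.I * (Real.sqrt d : ℂ)) ^ (2 * n) • c₁) ∧ (∀ x y : ℕ, Literature.AlgebraicTopology.SingularHomology.singularCohomology.map ℂ ℂ (Literature.AlgebraicGeometry.Motives.AlgPoints.mapContinuous (L := ℂ) (x • CategoryTheory.CategoryStruct.id A + y • φ).hom.hom.hom) (2 * n) c₂ = ((x : ℂ) - (y : ℂ) * Complex.I * (Real.sqrt d : ℂ)) ^ (2 * n) • c₂)) → c ∈ Literature.AlgebraicGeometry.HodgeTheory.algebraicClasses A.X n) → HodgeConjecture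

end Summit.HodgeConjecture.HodgeConjecture.Theses.TropicalCuspLift
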